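import Literature.NumberTheory.GaloisRepresentations.HochschildSerreLowDegree
import HarnessLib

/-!
# Naturality of the connecting maps `δ₀`, `δ₁` in the module, and functoriality of the coinduced shift

For a locally compact (e.g. profinite) group `Γ` and a MORPHISM of short exact sequences of discrete
`Γ`-modules

  `0 → M₁ → M₂ → M₃ → 0`
  `     ↓φ₁   ↓φ₂   ↓φ₃`
  `0 → M₁' → M₂' → M₃' → 0`

(commuting squares), the connecting homomorphisms of `ContinuousCohomologyConnecting.lean` are
natural: `H¹(φ₁) ∘ δ₀ = δ₀' ∘ φ₃` on invariants and `H²(φ₁) ∘ δ₁ = δ₁' ∘ H¹(φ₃)`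
(`IsSES.cohomologyMap_δ₀`, `IsSES.cohomologyMap_δ₁`; the tree's `IsSES.pullH_δ₁` /
`resSubgroup_δ₁` are the naturality in the GROUP).  On cocycles: the image of a lift is a lift of
the image (Serre, *Cohomologie galoisienne*, I §2.2–2.3; NSW (1.3.2)–(1.3.3): the long exact sequence
is functorial in morphisms of short exact sequences).

Second, the dimension-shifting sequence `0 → M → C(Γ, M) → Q → 0` of `DiscreteCochains.lean`
(`ContinuousRep.coind`, `coindι`, `coindQuot`, `coindπ`) is FUNCTORIAL in the discrete module `M`
(compact `Γ`): a morphism `φ : M → M'` induces `coindHom φ : C(Γ, M) → C(Γ, M')` (post-composition)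
and `coindQuotHom φ : Q → Q'`, forming a morphism of short exact sequences
(`coindι_coindHom`, `coindπ_coindQuotHom`).  Together with the invariants functor
`ContinuousRep.invariantsHom` (`M^N → M'^N`) and the inflation `infOne`
(`cohomologyMap_infOne`: `H¹(φ) ∘ Inf = Inf ∘ H¹(φ^N)`), this is the bookkeeping behind the
naturality of the Hochschild–Serre edge in the coefficient module (`HochschildSerreEdgeNaturality.lean`),
needed to transport compatible families along the tower `ℤ/l^{i+1} → ℤ/lⁱ` in the proof of
[AbsTopI] Thm. 2.6 (iii) (S. Mochizuki, *Topics in Absolute Anabelian Geometry I*, p. 23).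

Classical, undisputed; nothing here bears on [IUTchIII] Cor. 3.12.

## References
* J.-P. Serre, *Galois Cohomology* (1997), I §2.2–2.3. [SerreGaloisCohomology1997]
* J. Neukirch, A. Schmidt, K. Wingberg, *Cohomology of Number Fields*, 2nd ed. (2008), (1.3.2),
  (1.3.3). [NeukirchSchmidtWingberg2008]
-/

noncomputable section

open CategoryTheory ContinuousCohomology Function

universe u

namespace Literature.NumberTheory.GaloisRepresentations

open _root_.TopRep _root_.Topology _root_.Filter

/-! ### Naturality of `δ₀` and `δ₁` in morphisms of short exact sequences -/

namespace IsSES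

section Naturality

variable {Γ : Type u} [Group Γ] [TopologicalSpace Γ] [IsTopologicalGroup Γ] [LocallyCompactSpace Γ]
variable {M₁ : Type u} [AddCommGroup M₁] [TopologicalSpace M₁] [DiscreteTopology M₁]
variable {M₂ : Type u} [AddCommGroup M₂] [TopologicalSpace M₂] [DiscreteTopology M₂]
variable {M₃ : Type u} [AddCommGroup M₃] [TopologicalSpace M₃] [DiscreteTopology M₃]
variable {M₁' : Type u} [AddCommGroup M₁'] [TopologicalSpace M₁'] [DiscreteTopology M₁']
variable {M₂' : Type u} [AddCommGroup M₂'] [TopologicalSpace M₂'] [DiscreteTopology M₂']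
variable {M₃' : Type u} [AddCommGroup M₃'] [TopologicalSpace M₃'] [DiscreteTopology M₃']
variable {ρ₁ : ContinuousRep Γ ℤ M₁} {ρ₂ : ContinuousRep Γ ℤ M₂} {ρ₃ : ContinuousRep Γ ℤ M₃}
variable {ρ₁' : ContinuousRep Γ ℤ M₁'} {ρ₂' : ContinuousRep Γ ℤ M₂'} {ρ₃' : ContinuousRep Γ ℤ M₃'}
variable {f : ρ₁.toTopRep ⟶ ρ₂.toTopRep} {g : ρ₂.toTopRep ⟶ ρ₃.toTopRep}
variable {f' : ρ₁'.toTopRep ⟶ ρ₂'.toTopRep} {g' : ρ₂'.toTopRep ⟶ ρ₃'.toTopRep}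
variable {φ₁ : ρ₁.toTopRep ⟶ ρ₁'.toTopRep} {φ₂ : ρ₂.toTopRep ⟶ ρ₂'.toTopRep}
  {φ₃ : ρ₃.toTopRep ⟶ ρ₃'.toTopRep}

omit [IsTopologicalGroup Γ] [LocallyCompactSpace Γ] in
/-- A morphism of short exact sequences carries invariants of `M₃` to invariants of `M₃'`.
[cite: SerreGaloisCohomology1997, I §2.2] -/
theorem mem_invariants_map (hsq₂ : ∀ y, φ₃.hom (g.hom y) = g'.hom (φ₂.hom y))
    (v : ρ₃.toTopRep.ρ.invariants) : φ₃.hom (v : M₃) ∈ ρ₃'.toTopRep.ρ.invariants := fun σ => by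
  have _ := hsq₂
  change ρ₃' σ (φ₃.hom v) = φ₃.hom v
  rw [← ContinuousRep.hom_comm_apply φ₃ σ]
  exact congrArg φ₃.hom (v.2 σ)

omit [LocallyCompactSpace Γ] in
/-- **Naturality of `δ₀`**: for a morphism `(φ₁, φ₂, φ₃)` of short exact sequences of discrete
`Γ`-modules, `H¹(φ₁) (δ₀ v) = δ₀' (φ₃ v)` for every invariant `v` of `M₃` (the image `φ₂ w` of a lift
`w` of `v` lifts `φ₃ v`). [cite: SerreGaloisCohomology1997, I §2.2] [cite: NeukirchSchmidtWingberg2008, (1.3.3)] -/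
theorem cohomologyMap_δ₀ (h : IsSES f g) (h' : IsSES f' g')
    (hsq₁ : ∀ x, φ₂.hom (f.hom x) = f'.hom (φ₁.hom x))
    (hsq₂ : ∀ y, φ₃.hom (g.hom y) = g'.hom (φ₂.hom y))
    (v : ρ₃.toTopRep.ρ.invariants) :
    cohomologyMap φ₁ 1 (h.δ₀ v) =
      h'.δ₀ ⟨φ₃.hom (v : M₃), mem_invariants_map hsq₂ v⟩ := by
  have hw : g.hom (h.lift v.1) = v := h.g_lift v.1
  have hw' : g'.hom (φ₂.hom (h.lift v.1)) = φ₃.hom (v : M₃) := by rw [← hsq₂, hw]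
  rw [h.δ₀_apply_eq v (h.lift v.1) hw, h'.δ₀_apply_eq _ (φ₂.hom (h.lift v.1)) hw',
    cohomologyMap_oneCocycleClass]
  refine congrArg _ (Subtype.ext (ContinuousMap.ext fun σ => h'.injective ?_))
  rw [pullback_id_resIdHom_apply, h'.f_δ₀Cocycle_apply, ← hsq₁, h.f_δ₀Cocycle_apply, map_sub,
    ContinuousRep.hom_comm_apply φ₂ σ]

/-- **Naturality of `δ₁`**: for a morphism `(φ₁, φ₂, φ₃)` of short exact sequences of discrete
`Γ`-modules, `H²(φ₁) (δ₁ x) = δ₁' (H¹(φ₃) x)` (the image `φ₂ ∘ φ̃` of a continuous lift `φ̃` of a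
crossed homomorphism `ψ` lifts `φ₃ ∘ ψ`, and `φ₁` carries the connecting cocycle of `φ̃` to that of
`φ₂ ∘ φ̃`). [cite: SerreGaloisCohomology1997, I §2.3] [cite: NeukirchSchmidtWingberg2008, (1.3.3)] -/
theorem cohomologyMap_δ₁ (h : IsSES f g) (h' : IsSES f' g')
    (hsq₁ : ∀ x, φ₂.hom (f.hom x) = f'.hom (φ₁.hom x))
    (hsq₂ : ∀ y, φ₃.hom (g.hom y) = g'.hom (φ₂.hom y))
    (x : continuousCohomology 1 ρ₃.toTopRep) :
    cohomologyMap φ₁ 2 (h.δ₁ x) = h'.δ₁ (cohomologyMap φ₃ 1 x) := by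
  obtain ⟨ψ, rfl⟩ := oneCocycleClass_surjective _ x
  -- the canonical lift `φ̃` of `ψ` and its image `φ₂ ∘ φ̃`
  let φt : C(Γ, M₂) := h.liftCocycle ψ
  let φt' : C(Γ, M₂') := (φ₂.hom : C(M₂, M₂')).comp φt
  have hφt' : ∀ σ τ, g'.hom (φt' (σ * τ)) = g'.hom (φt' σ) + ρ₃' σ (g'.hom (φt' τ)) := fun σ τ => by
    change g'.hom (φ₂.hom (φt (σ * τ))) = g'.hom (φ₂.hom (φt σ)) + ρ₃' σ (g'.hom (φ₂.hom (φt τ)))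
    rw [← hsq₂, ← hsq₂, ← hsq₂, h.liftCocycle_isLift ψ σ τ, map_add,
      ContinuousRep.hom_comm_apply φ₃ σ]
  -- `H¹(φ₃) [ψ] = [g' ∘ (φ₂ ∘ φ̃)]`
  have e1 : cohomologyMap φ₃ 1 (oneCocycleClass _ ψ) = oneCocycleClass _ (pushCocycle φt' hφt') := by
    rw [cohomologyMap_oneCocycleClass]
    refine congrArg _ (Subtype.ext (ContinuousMap.ext fun σ => ?_))
    rw [pullback_id_resIdHom_apply, pushCocycle_apply]
    change φ₃.hom (ψ.1 σ) = g'.hom (φ₂.hom (h.liftCocycle ψ σ))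
    rw [← hsq₂, h.g_liftCocycle_apply]
  have e0 : oneCocycleClass _ ψ = oneCocycleClass _ (pushCocycle φt (h.liftCocycle_isLift ψ)) := by
    rw [h.pushCocycle_liftCocycle ψ]
  rw [e1, h'.δ₁_oneCocycleClass φt' hφt', e0, h.δ₁_oneCocycleClass φt (h.liftCocycle_isLift ψ),
    cohomologyMap_twoCocycleClass]
  refine congrArg _ (Subtype.ext (ContinuousMap.ext fun p => ?_))
  obtain ⟨σ, τ⟩ := p
  apply h'.injective
  rw [pullback₂_id_resIdHom_apply, h'.f_connectingCocycle_apply, ← hsq₁, h.f_connectingCocycle_apply,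
    map_add, map_sub, ContinuousRep.hom_comm_apply φ₂ σ]
  rfl

end Naturality

end IsSES

/-! ### Functoriality of the coinduced shift `0 → M → C(Γ, M) → Q → 0` in `M` -/

namespace ContinuousRep

variable {Γ : Type u} [Group Γ] [TopologicalSpace Γ] [IsTopologicalGroup Γ] [CompactSpace Γ]
variable {M : Type u} [AddCommGroup M] [TopologicalSpace M] [DiscreteTopology M]
variable {M' : Type u} [AddCommGroup M'] [TopologicalSpace M'] [DiscreteTopology M']
variable {ρ : ContinuousRep Γ ℤ M} {ρ' : ContinuousRep Γ ℤ M'}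

/-- **`C(Γ, φ) : C(Γ, M) → C(Γ, M')`**, post-composition with a morphism `φ : M → M'` of discrete
`Γ`-modules, as a morphism of the coinduced modules (`(g • F)(x) = g • F(g⁻¹x)` is respected since
`φ` is equivariant). [cite: SerreGaloisCohomology1997, I §2.5] -/
def coindHom (φ : ρ.toTopRep ⟶ ρ'.toTopRep) : ρ.coind.toTopRep ⟶ ρ'.coind.toTopRep :=
  TopRep.ofHom
    ⟨⟨{ toFun := fun F => (φ.hom : C(M, M')).comp F
        map_add' := fun F F' => by ext x; exact map_add φ.hom (F x) (F' x)
        map_smul' := fun n F => by ext x; exact map_zsmul φ.hom n (F x) },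
      continuous_of_discreteTopology⟩, fun σ => by
      ext F x
      change φ.hom (ρ σ (F (σ⁻¹ * x))) = ρ' σ (φ.hom (F (σ⁻¹ * x)))
      exact ContinuousRep.hom_comm_apply φ σ _⟩

/-- Unfolding `coindHom`: `(C(Γ, φ) F)(x) = φ (F x)`. [cite: SerreGaloisCohomology1997, I §2.5] -/
@[simp] theorem coindHom_hom_apply (φ : ρ.toTopRep ⟶ ρ'.toTopRep) (F : C(Γ, M)) (x : Γ) :
    ((coindHom φ).hom F : C(Γ, M')) x = φ.hom (F x) := rfl

/-- The square `M → C(Γ, M)`, `M' → C(Γ, M')` commutes: `C(Γ, φ) (const m) = const (φ m)`.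
[cite: SerreGaloisCohomology1997, I §2.5] -/
theorem coindι_coindHom (φ : ρ.toTopRep ⟶ ρ'.toTopRep) (m : M) :
    (coindHom φ).hom (ρ.coindι.hom m) = ρ'.coindι.hom (φ.hom m) := by
  ext x; rfl

/-- `C(Γ, φ)` maps constants to constants. [cite: SerreGaloisCohomology1997, I §2.5] -/
theorem constSubmodule_le_comap_coindHom (φ : ρ.toTopRep ⟶ ρ'.toTopRep) :
    ρ.constSubmodule ≤ ρ'.constSubmodule.comap (coindHom φ).hom.toLinearMap := by
  rintro _ ⟨m, rfl⟩
  exact ⟨φ.hom m, (coindι_coindHom φ m).symm⟩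

/-- **`Q(φ) : Q → Q'`**, the map of dimension-shifting quotients `C(Γ, M)/M → C(Γ, M')/M'` induced by
`C(Γ, φ)`. [cite: SerreGaloisCohomology1997, I §2.5] -/
def coindQuotHom (φ : ρ.toTopRep ⟶ ρ'.toTopRep) : ρ.coindQuot.toTopRep ⟶ ρ'.coindQuot.toTopRep :=
  TopRep.ofHom
    ⟨⟨Submodule.mapQ ρ.constSubmodule ρ'.constSubmodule (coindHom φ).hom.toLinearMap
        (constSubmodule_le_comap_coindHom φ), continuous_of_discreteTopology⟩, fun σ => by
      ext q
      obtain ⟨F, rfl⟩ := Submodule.Quotient.mk_surjective _ q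
      change Submodule.Quotient.mk ((coindHom φ).hom (ρ.coind σ F)) =
        (Submodule.Quotient.mk (ρ'.coind σ ((coindHom φ).hom F)) : C(Γ, M') ⧸ ρ'.constSubmodule)
      rw [ContinuousRep.hom_comm_apply (coindHom φ) σ F]⟩

/-- The square `C(Γ, M) → Q`, `C(Γ, M') → Q'` commutes. [cite: SerreGaloisCohomology1997, I §2.5] -/
@[simp] theorem coindπ_coindQuotHom (φ : ρ.toTopRep ⟶ ρ'.toTopRep) (F : C(Γ, M)) :
    (coindQuotHom φ).hom (ρ.coindπ.hom F) = ρ'.coindπ.hom ((coindHom φ).hom F) := rfl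

end ContinuousRep

/-! ### Naturality of inflation in degree one -/

section Inflation

variable {G : Type u} [Group G] [TopologicalSpace G] [IsTopologicalGroup G]
variable (N : Subgroup G) [N.Normal]
variable {M : Type u} [AddCommGroup M] [TopologicalSpace M] [DiscreteTopology M]
variable {M' : Type u} [AddCommGroup M'] [TopologicalSpace M'] [DiscreteTopology M']
variable {ρ : ContinuousRep G ℤ M} {ρ' : ContinuousRep G ℤ M'}

/-- **Naturality of inflation**: `H¹(φ) ∘ Inf = Inf ∘ H¹(φ^N)` for a morphism `φ : M → M'` of discrete
`G`-modules and its restriction `φ^N : M^N → M'^N` to invariants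
(`ContinuousRep.invariantsHom`). [cite: SerreGaloisCohomology1997, I §2.6] -/
theorem cohomologyMap_infOne (φ : ρ.toTopRep ⟶ ρ'.toTopRep)
    (y : continuousCohomology 1 (ρ.quotientInvariants N).toTopRep) :
    cohomologyMap φ 1 (infOne N ρ y) =
      infOne N ρ' (cohomologyMap (ContinuousRep.invariantsHom (N := N) φ) 1 y) := by
  obtain ⟨c, rfl⟩ := oneCocycleClass_surjective _ y
  have e1 : infOne N ρ (oneCocycleClass _ c) = oneCocycleClass _
      (contOneCocycles.pullback (ContinuousMonoidHom.quotientMk N) (invariantsIncl N ρ) c) :=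
    map_oneCocycleClass _ _ _ c
  have e2 : cohomologyMap (ContinuousRep.invariantsHom (N := N) φ) 1 (oneCocycleClass _ c) =
      oneCocycleClass _ (contOneCocycles.pullback (ContinuousMonoidHom.id _)
        (resIdHom (ContinuousRep.invariantsHom (N := N) φ)) c) :=
    cohomologyMap_oneCocycleClass _ c
  rw [e1, e2, cohomologyMap_oneCocycleClass]
  have e3 : infOne N ρ' (oneCocycleClass _ (contOneCocycles.pullback (ContinuousMonoidHom.id _)
        (resIdHom (ContinuousRep.invariantsHom (N := N) φ)) c)) =
      oneCocycleClass _ (contOneCocycles.pullback (ContinuousMonoidHom.quotientMk N)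
        (invariantsIncl N ρ') (contOneCocycles.pullback (ContinuousMonoidHom.id _)
          (resIdHom (ContinuousRep.invariantsHom (N := N) φ)) c)) :=
    map_oneCocycleClass _ _ _ _
  rw [e3]
  exact congrArg _ (Subtype.ext (ContinuousMap.ext fun σ => rfl))

end Inflation

end Literature.NumberTheory.GaloisRepresentations

end
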